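import Summits.KontsevichZagierPeriods.KontsevichZagierPeriods.Theses.CyclesAsDomains
import Literature.NumberTheory.Transcendental.KZLogCalculusProofs
import Literature.NumberTheory.Transcendental.SemialgebraicCubicalChain

/-!
# `ZeroBulkStokes` (stmt-KontsevichZagierPeriods-6589, route CyclesAsDomains) — birth skeleton (BC3)

ZERO-BULK (CLOSED-FORM) STOKES ON THE CLOSED UNIT CUBE IS A DERIVED RULE of the fixed
Kontsevich–Zagier calculus of moves: for `ℚ`-semialgebraic coefficients `A₀, …, A_d` on
`C = [0,1]^(d+1)` with fibrewise primitives (`t ↦ A_k(… t …)` continuous on `[0,1]`, differentiable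
on `(0,1)` with derivative `B_k`, exactly the regularity of `KZ.newtonLeibnizRel`), `B_k` integrable
on `C`, and CLOSEDNESS `Σ_k (−1)^k B_k = 0` on the open cube, the zero-bulk Stokes element
`Σ_k (−1)^k ([ρ₁ k] − [ρ₀ k])` of the `2(d+1)` face representations lies in `KZ.relations`.

Registered line (three stubs, each a genuine lemma about the fixed calculus, none mentioning faces
AND closedness together; `zeroBulkStokes_of_stubs` is their kernel-checked composition into the crux
body and `ZeroBulkStokes_of : ZeroBulkStokes` the by-name skeleton theorem fed by the three stubs):

* `stub_coordinateCycle` — cycling the coordinate `k` to the last slot,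
  `z ↦ Fin.insertNth k (z last) (Fin.init z)`, is a move on the CLOSED unit cube for an ARBITRARY
  integrand (one rule-(2) instance with a permutation matrix, `|det| = 1`);
* `stub_lastNewtonLeibniz` — Newton–Leibniz along the LAST coordinate of the closed cube with the
  bulk term, under the crux's FIBREWISE regularity only: `[C, B] − [C_d, A(·,1)] + [C_d, A(·,0)] ∈
  relations` (the closed cube is literally the band over the closed `d`-cube with `a = 0`, `b = 1`:
  one rule-(3) instance + rule (1b));
* `stub_signedBulkVanishes` — a `ℤ`-combination of representations on the closed cube whose
  integrands combine to `0` on the OPEN cube is a relation (iterated rule (1b), then rule (1a) with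
  the null boundary `C ∖ (0,1)^n`).

The assembly transports `A_k`, `B_k` through the coordinate cycle (semialgebraicity by
`IsSemialgebraicFunOn.comp_equiv`, absolute integrability by the volume-preserving relabelling
`MeasurableEquiv.piCongrLeft`, the fibrewise data by `Fin.snoc_last`/`Fin.init_snoc`), builds the
honest bulk representations `β k = [C, B_k]` and their cycled copies, and collects the signs in the
free abelian group:
`Σ_k (−1)^k ([ρ₁ k] − [ρ₀ k]) = Σ_k (−1)^k [β k] − Σ_k (−1)^k (([β k] − [β̃ k]) + ([β̃ k] − [ρ₁ k] + [ρ₀ k]))`.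

This is the closed-cube / fibrewise-regularity twin of the typed decomposition of the sibling item
`CobordismMove.CubeStokes` (stmt-5566: `CubeCoordinateCycle`, `CubeLastNewtonLeibniz`,
`ZeroCombination`, all proved in `Cruxes/CubeStokes/CubeStokesProof.lean`), whose proofs port to the
three stubs (closed cube: no null-face re-domaining in the Newton–Leibniz step; the null boundary
moves into the vanishing step instead).

References: M. Kontsevich, D. Zagier, *Periods* (2001), §1.2, rules (1)–(3); A. Huber,
S. Müller-Stach, *Periods and Nori Motives* (2017), §13.1; J. Bochnak, M. Coste, M.-F. Roy,
*Real Algebraic Geometry* (1998), §2.2.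
-/

noncomputable section

set_option linter.dupNamespace false

open MeasureTheory Set
open Literature.NumberTheory.Transcendental
open Literature.ModelTheory.ExponentialFields (IsSemialgebraic)

namespace Summit.KontsevichZagierPeriods.KontsevichZagierPeriods.Cruxes.ZeroBulkStokes.Birth

open Summit.KontsevichZagierPeriods.KontsevichZagierPeriods.Theses.CyclesAsDomains

/-! ## The registered stubs -/

/-- **Stub 1 (coordinate cycle on the closed cube).** Cycling the coordinate `k` of the closed unit
cube to the last slot is a move, for an arbitrary integrand: one `changeOfVariablesRel` instance with
the coordinate relabelling (a `ℚ`-polynomial map, injective, cube onto cube, `|det| = 1`).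
[cite: KontsevichZagier2001, §1.2 rule (2)] -/
theorem stub_coordinateCycle :
    ∀ (d : ℕ) (k : Fin (d + 1))
      (R R' : Literature.NumberTheory.Transcendental.KZ.IntegralRep (d + 1)),
      R.domain = {z : Fin (d + 1) → ℝ | ∀ i, z i ∈ Set.Icc (0:ℝ) 1} →
      R'.domain = {z : Fin (d + 1) → ℝ | ∀ i, z i ∈ Set.Icc (0:ℝ) 1} →
      Set.EqOn R'.integrand
        (fun z => R.integrand (Fin.insertNth k (z (Fin.last d)) (Fin.init z))) R'.domain →
      Literature.NumberTheory.Transcendental.KZ.of R - Literature.NumberTheory.Transcendental.KZ.of R' ∈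
        Literature.NumberTheory.Transcendental.KZ.relations := by
  sorry

/-- **Stub 2 (Newton–Leibniz along the last coordinate of the closed cube, bulk term included).**
For ONE coefficient `A`, `ℚ`-semialgebraic on the closed `(d+1)`-cube `C`, with the crux's fibrewise
regularity (continuous on each closed fibre `[0,1]`, derivative `B` on the open fibre) over EVERY
point of the closed `d`-cube, a bulk representation `R = [C, B]` and face representations
`r₁ = [C_d, A(·,1)]`, `r₀ = [C_d, A(·,0)]`: `[R] − [r₁] + [r₀] ∈ KZ.relations`. The closed cube is
the band `{z | init z ∈ C_d ∧ 0 ≤ z last ≤ 1}`: one `newtonLeibnizRel` instance with primitive `A`,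
then integrand additivity. [cite: KontsevichZagier2001, §1.2 rule (3)] -/
theorem stub_lastNewtonLeibniz :
    ∀ (d : ℕ) (A B : (Fin (d + 1) → ℝ) → ℝ)
      (R : Literature.NumberTheory.Transcendental.KZ.IntegralRep (d + 1))
      (r₁ r₀ : Literature.NumberTheory.Transcendental.KZ.IntegralRep d),
      Literature.NumberTheory.Transcendental.IsSemialgebraicFunOn ℚ
        {z : Fin (d + 1) → ℝ | ∀ i, z i ∈ Set.Icc (0:ℝ) 1} A →
      R.domain = {z : Fin (d + 1) → ℝ | ∀ i, z i ∈ Set.Icc (0:ℝ) 1} →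
      Set.EqOn R.integrand B R.domain →
      (∀ x : Fin d → ℝ, (∀ i, x i ∈ Set.Icc (0:ℝ) 1) →
        ContinuousOn (fun t : ℝ => A (Fin.snoc x t)) (Set.Icc 0 1) ∧
          ∀ t ∈ Set.Ioo (0:ℝ) 1,
            HasDerivAt (fun s : ℝ => A (Fin.snoc x s)) (B (Fin.snoc x t)) t) →
      r₁.domain = {x : Fin d → ℝ | ∀ i, x i ∈ Set.Icc (0:ℝ) 1} →
      r₀.domain = {x : Fin d → ℝ | ∀ i, x i ∈ Set.Icc (0:ℝ) 1} →
      Set.EqOn r₁.integrand (fun x => A (Fin.snoc x 1)) r₁.domain →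
      Set.EqOn r₀.integrand (fun x => A (Fin.snoc x 0)) r₀.domain →
      Literature.NumberTheory.Transcendental.KZ.of R - Literature.NumberTheory.Transcendental.KZ.of r₁ +
          Literature.NumberTheory.Transcendental.KZ.of r₀ ∈
        Literature.NumberTheory.Transcendental.KZ.relations := by
  sorry

/-- **Stub 3 (closedness kills the signed bulk sum).** A `ℤ`-combination of integral representations
on the CLOSED unit cube whose integrands combine to `0` at every point of the OPEN unit cube lies in
`KZ.relations`: integer multiples and sums by iterated integrand additivity (rule (1b)) down to one
representation `[C, Σ cⱼ fⱼ]`, then domain additivity (rule (1a)) into the open cube, where the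
integrand vanishes, and the Lebesgue-null boundary `C ∖ (0,1)^n`.
[cite: KontsevichZagier2001, §1.2 rule (1)] -/
theorem stub_signedBulkVanishes :
    ∀ (n N : ℕ) (R : Fin N → Literature.NumberTheory.Transcendental.KZ.IntegralRep n) (c : Fin N → ℤ),
      (∀ j, (R j).domain = {z : Fin n → ℝ | ∀ i, z i ∈ Set.Icc (0:ℝ) 1}) →
      (∀ z : Fin n → ℝ, (∀ i, z i ∈ Set.Ioo (0:ℝ) 1) → ∑ j, (c j : ℝ) * (R j).integrand z = 0) →
      (∑ j, c j • Literature.NumberTheory.Transcendental.KZ.of (R j)) ∈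
        Literature.NumberTheory.Transcendental.KZ.relations := by
  sorry

/-! ## Transport through coordinate cycles (sorry-free helpers of the assembly) -/

variable {d : ℕ}

/-- The coordinate cycle `z ↦ Fin.insertNth k (z last) (Fin.init z)` of `ℝ^(d+1)` is the
relabelling of coordinates along an index permutation (namely
`(finSuccEquiv' k).trans (finSuccEquiv' (Fin.last d)).symm`: `k ↦ last`, `k.succAbove j ↦ j.castSucc`).
[folklore] -/
theorem exists_perm_insertNth (k : Fin (d + 1)) :
    ∃ e : Equiv.Perm (Fin (d + 1)), ∀ z : Fin (d + 1) → ℝ,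
      (fun i => z (e i)) = (Fin.insertNth k (z (Fin.last d)) (Fin.init z) : Fin (d + 1) → ℝ) := by
  refine ⟨(finSuccEquiv' k).trans (finSuccEquiv' (Fin.last d)).symm, fun z => ?_⟩
  funext i
  rcases Fin.eq_self_or_eq_succAbove k i with rfl | ⟨j, rfl⟩
  · simp [finSuccEquiv'_at, finSuccEquiv'_symm_none, Fin.insertNth_apply_same]
  · simp [finSuccEquiv'_succAbove, finSuccEquiv'_symm_some, Fin.insertNth_apply_succAbove,
      Fin.succAbove_last, Fin.init]

/-- The closed unit cube is invariant under relabelling coordinates. [folklore] -/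
theorem comp_perm_mem_closedCube_iff {n : ℕ} (e : Equiv.Perm (Fin n)) (z : Fin n → ℝ) :
    (fun i => z (e i)) ∈ {x : Fin n → ℝ | ∀ i, x i ∈ Icc (0 : ℝ) 1} ↔
      z ∈ {x : Fin n → ℝ | ∀ i, x i ∈ Icc (0 : ℝ) 1} := by
  simp only [mem_setOf_eq]
  exact ⟨fun h i => by simpa using h (e.symm i), fun h i => h (e i)⟩

/-- The closed unit cube `{x | ∀ i, x i ∈ [0,1]}` is `ℚ`-semialgebraic. [folklore] -/
theorem isSemialgebraic_closedCube (n : ℕ) :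
    IsSemialgebraic ℚ {x : Fin n → ℝ | ∀ i, x i ∈ Icc (0 : ℝ) 1} := by
  rw [← closedUnitCube_eq_setOf]
  exact isSemialgebraic_closedUnitCube

/-- The closed unit cube `{x | ∀ i, x i ∈ [0,1]}` is Lebesgue measurable. [folklore] -/
theorem measurableSet_closedCube (n : ℕ) :
    MeasurableSet {x : Fin n → ℝ | ∀ i, x i ∈ Icc (0 : ℝ) 1} := by
  rw [← closedUnitCube_eq_setOf]
  exact isCompact_closedUnitCube.measurableSet

/-- Semialgebraicity on the closed unit cube is invariant under relabelling coordinates.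
[cite: BochnakCosteRoy1998, §2.2] -/
theorem isSemialgebraicFunOn_comp_perm_closedCube {n : ℕ} (e : Equiv.Perm (Fin n))
    {f : (Fin n → ℝ) → ℝ}
    (hf : IsSemialgebraicFunOn ℚ {x : Fin n → ℝ | ∀ i, x i ∈ Icc (0 : ℝ) 1} f) :
    IsSemialgebraicFunOn ℚ {x : Fin n → ℝ | ∀ i, x i ∈ Icc (0 : ℝ) 1}
      (fun z => f (fun i => z (e i))) := by
  have h := hf.comp_equiv e
  have hset : {w : Fin n → ℝ | (fun i => w (e i)) ∈ {x : Fin n → ℝ | ∀ i, x i ∈ Icc (0 : ℝ) 1}} =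
      {x : Fin n → ℝ | ∀ i, x i ∈ Icc (0 : ℝ) 1} := by
    ext w
    exact comp_perm_mem_closedCube_iff e w
  rwa [hset] at h

/-- Absolute integrability on the closed unit cube is invariant under relabelling coordinates: the
relabelling is the volume-preserving `MeasurableEquiv.piCongrLeft` and preserves the cube.
[folklore] -/
theorem integrableOn_comp_perm_closedCube {n : ℕ} (e : Equiv.Perm (Fin n)) {f : (Fin n → ℝ) → ℝ}
    (hf : IntegrableOn f {x : Fin n → ℝ | ∀ i, x i ∈ Icc (0 : ℝ) 1}) :
    IntegrableOn (fun z => f (fun i => z (e i))) {x : Fin n → ℝ | ∀ i, x i ∈ Icc (0 : ℝ) 1} := by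
  set L : (Fin n → ℝ) ≃ᵐ (Fin n → ℝ) := MeasurableEquiv.piCongrLeft (fun _ : Fin n => ℝ) e.symm
    with hL_def
  have hL : MeasurePreserving L volume volume :=
    volume_measurePreserving_piCongrLeft (fun _ : Fin n => ℝ) e.symm
  have hLapply : ∀ z : Fin n → ℝ, L z = fun i => z (e i) := by
    intro z
    funext i
    have h := Equiv.piCongrLeft_apply_apply (fun _ : Fin n => ℝ) e.symm z (e i)
    rw [hL_def, MeasurableEquiv.coe_piCongrLeft]
    simpa using h
  have hpre : L ⁻¹' {x : Fin n → ℝ | ∀ i, x i ∈ Icc (0 : ℝ) 1} =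
      {x : Fin n → ℝ | ∀ i, x i ∈ Icc (0 : ℝ) 1} := by
    ext z
    rw [mem_preimage, hLapply]
    exact comp_perm_mem_closedCube_iff e z
  have h := (hL.integrableOn_comp_preimage L.measurableEmbedding (f := f)
    (s := {x : Fin n → ℝ | ∀ i, x i ∈ Icc (0 : ℝ) 1})).mpr hf
  rw [hpre] at h
  exact h.congr_fun (fun z _ => by simp only [Function.comp_apply, hLapply])
    (measurableSet_closedCube n)

/-! ## The kernel-checked composition -/

/-- **`ZeroBulkStokes` from the three stubs** (arrow form; the conclusion is the crux body UNFOLDED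
verbatim, so that exactly one theorem of this file, `ZeroBulkStokes_of`, concludes the crux by its
route name). For each coordinate `k` the coefficient `A_k` and its
fibrewise derivative `B_k` are transported through the coordinate cycle
`z ↦ Fin.insertNth k (z last) (Fin.init z)`; the honest bulk representation `β k = [C, B_k]` and its
cycled copy `β̃ k` are built; stub 1 gives `[β k] − [β̃ k] ∈ relations`, stub 2 (with the crux's
fibrewise data read through `Fin.snoc_last`/`Fin.init_snoc`) gives
`[β̃ k] − [ρ₁ k] + [ρ₀ k] ∈ relations`, stub 3 with the closedness gives
`Σ_k (−1)^k [β k] ∈ relations`, and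
`Σ_k (−1)^k ([ρ₁ k] − [ρ₀ k]) = Σ_k (−1)^k [β k] − Σ_k (−1)^k (([β k] − [β̃ k]) + ([β̃ k] − [ρ₁ k] + [ρ₀ k]))`.
[cite: KontsevichZagier2001, §1.2] -/
theorem zeroBulkStokes_of_stubs
    (h₁ : ∀ (d : ℕ) (k : Fin (d + 1))
      (R R' : Literature.NumberTheory.Transcendental.KZ.IntegralRep (d + 1)),
      R.domain = {z : Fin (d + 1) → ℝ | ∀ i, z i ∈ Set.Icc (0:ℝ) 1} →
      R'.domain = {z : Fin (d + 1) → ℝ | ∀ i, z i ∈ Set.Icc (0:ℝ) 1} →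
      Set.EqOn R'.integrand
        (fun z => R.integrand (Fin.insertNth k (z (Fin.last d)) (Fin.init z))) R'.domain →
      Literature.NumberTheory.Transcendental.KZ.of R - Literature.NumberTheory.Transcendental.KZ.of R' ∈
        Literature.NumberTheory.Transcendental.KZ.relations)
    (h₂ : ∀ (d : ℕ) (A B : (Fin (d + 1) → ℝ) → ℝ)
      (R : Literature.NumberTheory.Transcendental.KZ.IntegralRep (d + 1))
      (r₁ r₀ : Literature.NumberTheory.Transcendental.KZ.IntegralRep d),
      Literature.NumberTheory.Transcendental.IsSemialgebraicFunOn ℚ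
        {z : Fin (d + 1) → ℝ | ∀ i, z i ∈ Set.Icc (0:ℝ) 1} A →
      R.domain = {z : Fin (d + 1) → ℝ | ∀ i, z i ∈ Set.Icc (0:ℝ) 1} →
      Set.EqOn R.integrand B R.domain →
      (∀ x : Fin d → ℝ, (∀ i, x i ∈ Set.Icc (0:ℝ) 1) →
        ContinuousOn (fun t : ℝ => A (Fin.snoc x t)) (Set.Icc 0 1) ∧
          ∀ t ∈ Set.Ioo (0:ℝ) 1,
            HasDerivAt (fun s : ℝ => A (Fin.snoc x s)) (B (Fin.snoc x t)) t) →
      r₁.domain = {x : Fin d → ℝ | ∀ i, x i ∈ Set.Icc (0:ℝ) 1} →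
      r₀.domain = {x : Fin d → ℝ | ∀ i, x i ∈ Set.Icc (0:ℝ) 1} →
      Set.EqOn r₁.integrand (fun x => A (Fin.snoc x 1)) r₁.domain →
      Set.EqOn r₀.integrand (fun x => A (Fin.snoc x 0)) r₀.domain →
      Literature.NumberTheory.Transcendental.KZ.of R - Literature.NumberTheory.Transcendental.KZ.of r₁ +
          Literature.NumberTheory.Transcendental.KZ.of r₀ ∈
        Literature.NumberTheory.Transcendental.KZ.relations)
    (h₃ : ∀ (n N : ℕ) (R : Fin N → Literature.NumberTheory.Transcendental.KZ.IntegralRep n)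
      (c : Fin N → ℤ),
      (∀ j, (R j).domain = {z : Fin n → ℝ | ∀ i, z i ∈ Set.Icc (0:ℝ) 1}) →
      (∀ z : Fin n → ℝ, (∀ i, z i ∈ Set.Ioo (0:ℝ) 1) → ∑ j, (c j : ℝ) * (R j).integrand z = 0) →
      (∑ j, c j • Literature.NumberTheory.Transcendental.KZ.of (R j)) ∈
        Literature.NumberTheory.Transcendental.KZ.relations) :
    ∀ (d : ℕ) (A B : Fin (d + 1) → (Fin (d + 1) → ℝ) → ℝ) (ρ₁ ρ₀ : Fin (d + 1) → Literature.NumberTheory.Transcendental.KZ.IntegralRep d), (∀ k, Literature.NumberTheory.Transcendental.IsSemialgebraicFunOn ℚ {z : Fin (d + 1) → ℝ | ∀ i, z i ∈ Set.Icc (0:ℝ) 1} (A k)) → (∀ k, Literature.NumberTheory.Transcendental.IsSemialgebraicFunOn ℚ {z : Fin (d + 1) → ℝ | ∀ i, z i ∈ Set.Icc (0:ℝ) 1} (B k)) → (∀ k, MeasureTheory.IntegrableOn (B k) {z : Fin (d + 1) → ℝ | ∀ i, z i ∈ Set.Icc (0:ℝ) 1}) → (∀ k, ∀ x : Fin d →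 ℝ, (∀ i, x i ∈ Set.Icc (0:ℝ) 1) → ContinuousOn (fun t : ℝ => A k (Fin.insertNth k t x)) (Set.Icc 0 1) ∧ ∀ t ∈ Set.Ioo (0:ℝ) 1, HasDerivAt (fun s : ℝ => A k (Fin.insertNth k s x)) (B k (Fin.insertNth k t x)) t) → (∀ z : Fin (d + 1) → ℝ, (∀ i, z i ∈ Set.Ioo (0:ℝ) 1) → ∑ k : Fin (d + 1), (-1 : ℝ) ^ (k : ℕ) * B k z = 0) → (∀ k, (ρ₁ k).domain = {x | ∀ i, x i ∈ Set.Icc (0:ℝ) 1} ∧ (ρ₀ k).domain = {x | ∀ i, x i ∈ Set.Icc (0:ℝ) 1} ∧ Set.EqOn (ρ₁ k).integrand (fun x => A k (Fin.insertNth k 1 x)) {x | ∀ i, x i ∈ Set.Icc (0:ℝ) 1} ∧ Set.EqOn (ρ₀ k).integrand (fun x => A k (Fin.insertNth k 0 x)) {x | ∀ i, x i ∈ Set.Icc (0:ℝ) 1}) → (∑ k : Fin (d + 1), ((-1 : ℤ) ^ (k : ℕ)) • (Literature.NumberTheory.Transcendental.KZ.of (ρ₁ k) - Literature.NumberTheory.Transcendental.KZ.of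 (ρ₀ k))) ∈ Literature.NumberTheory.Transcendental.KZ.relations := by
  intro d A B ρ₁ ρ₀ hA hB hI hR h0 hF
  -- index permutations realising the coordinate cycles `z ↦ insertNth k (z last) (init z)`
  choose e he using fun k : Fin (d + 1) => exists_perm_insertNth (d := d) k
  have hCsa : IsSemialgebraic ℚ {z : Fin (d + 1) → ℝ | ∀ i, z i ∈ Set.Icc (0:ℝ) 1} :=
    isSemialgebraic_closedCube (d + 1)
  have hCm : MeasurableSet {z : Fin (d + 1) → ℝ | ∀ i, z i ∈ Set.Icc (0:ℝ) 1} :=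
    measurableSet_closedCube (d + 1)
  -- (a) transport of the coefficient data through the cycles
  have hAt : ∀ k : Fin (d + 1), IsSemialgebraicFunOn ℚ {z : Fin (d + 1) → ℝ | ∀ i, z i ∈ Set.Icc (0:ℝ) 1}
      (fun z => A k (Fin.insertNth k (z (Fin.last d)) (Fin.init z))) := fun k =>
    (isSemialgebraicFunOn_comp_perm_closedCube (e k) (hA k)).congr fun z _ => congrArg (A k) (he k z)
  have hBt : ∀ k : Fin (d + 1), IsSemialgebraicFunOn ℚ {z : Fin (d + 1) → ℝ | ∀ i, z i ∈ Set.Icc (0:ℝ) 1}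
      (fun z => B k (Fin.insertNth k (z (Fin.last d)) (Fin.init z))) := fun k =>
    (isSemialgebraicFunOn_comp_perm_closedCube (e k) (hB k)).congr fun z _ => congrArg (B k) (he k z)
  have hBtint : ∀ k : Fin (d + 1),
      IntegrableOn (fun z => B k (Fin.insertNth k (z (Fin.last d)) (Fin.init z)))
        {z : Fin (d + 1) → ℝ | ∀ i, z i ∈ Set.Icc (0:ℝ) 1} := fun k =>
    (integrableOn_comp_perm_closedCube (e k) (hI k)).congr_fun
      (fun z _ => congrArg (B k) (he k z)) hCm
  -- (b) the bulk representations `β k = [C, B k]` and their cycled copies `βt k`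
  have hβex : ∀ k : Fin (d + 1), ∃ Rk : KZ.IntegralRep (d + 1),
      Rk.domain = {z : Fin (d + 1) → ℝ | ∀ i, z i ∈ Set.Icc (0:ℝ) 1} ∧ Rk.integrand = B k := fun k =>
    ⟨⟨{z | ∀ i, z i ∈ Set.Icc (0:ℝ) 1}, B k, hCsa, hB k, hI k⟩, rfl, rfl⟩
  choose β hβd hβi using hβex
  have hβtex : ∀ k : Fin (d + 1), ∃ Rk : KZ.IntegralRep (d + 1),
      Rk.domain = {z : Fin (d + 1) → ℝ | ∀ i, z i ∈ Set.Icc (0:ℝ) 1} ∧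
        Rk.integrand = fun z => B k (Fin.insertNth k (z (Fin.last d)) (Fin.init z)) := fun k =>
    ⟨⟨{z | ∀ i, z i ∈ Set.Icc (0:ℝ) 1},
      fun z => B k (Fin.insertNth k (z (Fin.last d)) (Fin.init z)), hCsa, hBt k, hBtint k⟩, rfl, rfl⟩
  choose βt hβtd hβti using hβtex
  -- (c) the three pieces
  have hc1 : ∀ k : Fin (d + 1), KZ.of (β k) - KZ.of (βt k) ∈ KZ.relations := fun k =>
    h₁ d k (β k) (βt k) (hβd k) (hβtd k) fun z _ => by rw [hβti k, hβi k]
  have hc2 : ∀ k : Fin (d + 1), KZ.of (βt k) - KZ.of (ρ₁ k) + KZ.of (ρ₀ k) ∈ KZ.relations := by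
    intro k
    obtain ⟨hρ₁d, hρ₀d, hρ₁i, hρ₀i⟩ := hF k
    refine h₂ d (fun z => A k (Fin.insertNth k (z (Fin.last d)) (Fin.init z)))
      (fun z => B k (Fin.insertNth k (z (Fin.last d)) (Fin.init z))) (βt k) (ρ₁ k) (ρ₀ k)
      (hAt k) (hβtd k) (fun z _ => by rw [hβti k]) ?_ hρ₁d hρ₀d ?_ ?_
    · intro x hx
      have h := hR k x hx
      simpa only [Fin.snoc_last, Fin.init_snoc] using h
    · intro y hy
      rw [hρ₁d] at hy
      rw [hρ₁i hy]
      simp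
    · intro y hy
      rw [hρ₀d] at hy
      rw [hρ₀i hy]
      simp
  have hc3 : (∑ k : Fin (d + 1), ((-1 : ℤ) ^ (k : ℕ)) • KZ.of (β k)) ∈ KZ.relations := by
    refine h₃ (d + 1) (d + 1) β (fun k => (-1 : ℤ) ^ (k : ℕ)) (fun k => hβd k) fun z hz => ?_
    have h := h0 z hz
    simp only [hβi]
    push_cast
    exact h
  -- (d) signs in the free abelian group
  have key : ∀ k : Fin (d + 1),
      ((-1 : ℤ) ^ (k : ℕ)) • (KZ.of (ρ₁ k) - KZ.of (ρ₀ k)) =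
        ((-1 : ℤ) ^ (k : ℕ)) • KZ.of (β k) -
          ((-1 : ℤ) ^ (k : ℕ)) •
            ((KZ.of (β k) - KZ.of (βt k)) + (KZ.of (βt k) - KZ.of (ρ₁ k) + KZ.of (ρ₀ k))) := by
    intro k
    module
  rw [Finset.sum_congr rfl fun k _ => key k, Finset.sum_sub_distrib]
  exact KZ.relations.sub_mem hc3
    (KZ.relations.sum_mem fun k _ => KZ.relations.zsmul_mem (KZ.relations.add_mem (hc1 k) (hc2 k)) _)

/-- **The skeleton theorem** (concludes the crux `ZeroBulkStokes` BY NAME; `sorry` enters only through the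
three declared stubs, which are literally the hypotheses of the sorry-free composition
`zeroBulkStokes_of_stubs`): closing `stub_coordinateCycle`, `stub_lastNewtonLeibniz` and
`stub_signedBulkVanishes` closes the crux. [cite: KontsevichZagier2001, §1.2] -/
theorem ZeroBulkStokes_of : ZeroBulkStokes :=
  zeroBulkStokes_of_stubs stub_coordinateCycle stub_lastNewtonLeibniz stub_signedBulkVanishes

end Summit.KontsevichZagierPeriods.KontsevichZagierPeriods.Cruxes.ZeroBulkStokes.Birth
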